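import Literature.Geometry.Kaehler.AnalyticSetComponentsProofs
import Literature.Analysis.Complex.SeveralVariables
import Mathlib.Analysis.InnerProductSpace.PiL2
import Mathlib.Analysis.Normed.Lp.ProdLp
import HarnessLib

/-!
# Holomorphic sections through regular points adapted to a product decomposition

Layer `Literature/Geometry/Kaehler`, namespace `Literature.Geometry.Kaehler`; lane `lit-hodgefound`,
seat p07, programme «THE ANALYTIC CLASSES OF A COMPLEX TORUS FORM A RING», file 4 (files 1–3:
`ComplexTorusAnalyticClassesCupProductReduction.lean`, `HolomorphicChainSheetCoarea.lean`,
`AnalyticSetSlices.lean`). The implicit function theorem in the form used by the fibre formula: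

* §1 `SCV.exists_section_of_bijective` — **a regular point over a transversal linear map is a
  graph point**: if `A ∩ U = {g = 0} ∩ U` near `z₀` with `g : E → ℂᶜ` holomorphic, `dg(z₀)` onto, and
  `ℓ : E → P` is a complex-linear map with `(dg(z₀), ℓ) : E → ℂᶜ × P` bijective (i.e. `ℓ` restricts to
  an isomorphism of the tangent space `ker dg(z₀)` onto `P`), then on a neighbourhood `N` of `z₀`,
  `A ∩ N = s(W)` for a holomorphic SECTION `s : W → E` of `ℓ` (`ℓ (s w) = w`) over an open `W ⊆ P`,
  and `dg` is onto along `N` — [Chirka1989, A2.2 (implicit function theorem) and §2.3]: the holomorphic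
  straightening `Φ = (g, ℓ(· - z₀))` of the tree's `Literature.Analysis.Complex.SCV.exists_straightening`.
* §2 `exists_clm_forall_eq_zero_of_forall_exists` — linear algebra on `E = E₁ ⊞ E₂`: if a complex
  subspace `T` projects ONTO `E₂` and `dim T = q + dim E₂`, there is a complex-linear
  `ℓ₁ : E₁ → ℂ^q` with `(ℓ₁ ∘ pr₁, pr₂)` injective on `T`.
* §3 **`exists_adapted_section`** — at a NON-CRITICAL regular point `z₀` of `A ⊆ E₁ ⊞ E₂` (codimension
  `c`, tangent space projecting onto `E₂`), there are `ℓ₁ : E₁ → ℂ^q` (`q = dim E₁ - c`), the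
  complex-linear map `ℓ(x, y) = (ℓ₁ x, y) : E₁ ⊞ E₂ → ℂ^q ⊞ E₂`, an open `W` and a holomorphic section
  `s` of `ℓ` over `W` with `s(W) = A ∩ N` for an open `N ∋ z₀` all of whose points of `A` are regular of
  codimension `c` — the sheets "adapted to the second projection" over which file 2's local coarea
  formula is integrated.

Theorems only; no definitions, no named facts.

## References

* [Chirka1989] E. M. Chirka, *Complex Analytic Sets*, Kluwer 1989, §2.3 (regular points, p. 29),
  A2.2 (implicit function theorem, p. 305).
-/

noncomputable section

open scoped Manifold Topology
open Set Filter Module Function WithLp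

universe u

namespace Literature.Geometry.Kaehler

/-! ### §1 Sections over a transversal linear map -/

section Section

variable {E : Type*} [NormedAddCommGroup E] [NormedSpace ℂ E] [FiniteDimensional ℂ E]
  {P : Type*} [NormedAddCommGroup P] [NormedSpace ℂ P] [FiniteDimensional ℂ P]

/-- **A regular point over a transversal linear map is a graph point** ([Chirka1989, A2.2 and §2.3]):
if `A ∩ U = {g = 0} ∩ U` with `g` holomorphic on the open `U ∋ z₀`, `dg(z₀)` onto, and the
complex-linear `ℓ : E → P` makes `(dg(z₀), ℓ)` bijective, then there are an open `W ⊆ P`, a holomorphic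
`s : P → E` with `ℓ (s w) = w` on `W`, and an open `N ∋ z₀`, `N ⊆ U`, with `s(W) = A ∩ N` and `dg` onto at
every point of `N`. [cite: Chirka1989, A2.2 (implicit function theorem), p. 305] -/
theorem SCV.exists_section_of_bijective {A U : Set E} {z₀ : E} {c : ℕ} {g : E → (Fin c → ℂ)}
    (hU : IsOpen U) (hz₀U : z₀ ∈ U) (hz₀A : z₀ ∈ A) (hg : DifferentiableOn ℂ g U)
    (hAU : A ∩ U = U ∩ g ⁻¹' {0}) (ℓ : E →L[ℂ] P) (hbij : Bijective ((fderiv ℂ g z₀).prod ℓ)) :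
    ∃ (W : Set P) (s : P → E) (N : Set E), IsOpen W ∧ IsOpen N ∧ z₀ ∈ N ∧ N ⊆ U ∧
      DifferentiableOn ℂ s W ∧ (∀ w ∈ W, ℓ (s w) = w) ∧ s '' W = A ∩ N ∧
      ∀ z ∈ N, Surjective (fderiv ℂ g z) := by
  have hgz₀ : g z₀ = 0 := by
    have : z₀ ∈ U ∩ g ⁻¹' {0} := hAU ▸ ⟨hz₀A, hz₀U⟩
    exact this.2
  obtain ⟨S, T, Ψ, hSo, hz₀S, hSU, hTo, hΨ, hΦΨ, hΨΦ, hsurjS⟩ :=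
    Literature.Analysis.Complex.SCV.exists_straightening hg hU hz₀U ℓ hbij
  -- the section `s w = Ψ (0, w - ℓ z₀)` over `W = {w | (0, w - ℓ z₀) ∈ T}`
  set j : P → (Fin c → ℂ) × P := fun w ↦ ((0 : Fin c → ℂ), w - ℓ z₀) with hj
  have hjc : Continuous j := continuous_const.prodMk (continuous_id.sub continuous_const)
  have hjd : Differentiable ℂ j := (differentiable_const _).prodMk (differentiable_id.sub_const _)
  refine ⟨j ⁻¹' T, fun w ↦ Ψ (j w), S, hTo.preimage hjc, hSo, hz₀S, hSU,
    hΨ.comp hjd.differentiableOn (fun w hw ↦ hw), fun w hw ↦ ?_, ?_, fun z hz ↦ ?_⟩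
  · -- `ℓ (s w) = w`
    have h := (hΨΦ (j w) hw).2
    simp only [hj, Prod.mk.injEq, map_sub] at h
    have h2 := h.2
    rwa [sub_left_inj] at h2
  · -- `s(W) = A ∩ N`
    apply Subset.antisymm
    · rintro _ ⟨w, hw, rfl⟩
      have h := hΨΦ (j w) hw
      have hg0 : g (Ψ (j w)) = 0 := by
        have := congrArg Prod.fst h.2
        simpa [hj] using this
      have hmem : Ψ (j w) ∈ U ∩ g ⁻¹' {0} := ⟨hSU h.1, hg0⟩
      rw [← hAU] at hmem
      exact ⟨hmem.1, h.1⟩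
    · rintro z ⟨hzA, hzS⟩
      have hgz : g z = 0 := by
        have : z ∈ U ∩ g ⁻¹' {0} := hAU ▸ ⟨hzA, hSU hzS⟩
        exact this.2
      have h := hΦΨ z hzS
      rw [hgz] at h
      refine ⟨ℓ z, ?_, ?_⟩
      · show j (ℓ z) ∈ T
        simp only [hj, ← map_sub]
        exact h.1
      · show Ψ (j (ℓ z)) = z
        simp only [hj, ← map_sub]
        exact h.2
  · -- `dg` is onto along `N = S`
    intro y
    obtain ⟨v, hv⟩ := hsurjS z hz (y, 0)
    exact ⟨v, by simpa using congrArg Prod.fst hv⟩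

end Section

/-! ### §2 A complement adapted to a subspace projecting onto the second factor -/

section LinearAlgebra

variable {E₁ : Type u} [NormedAddCommGroup E₁] [NormedSpace ℂ E₁] [FiniteDimensional ℂ E₁]
  {E₂ : Type u} [NormedAddCommGroup E₂] [NormedSpace ℂ E₂] [FiniteDimensional ℂ E₂]

/-- **Linear algebra of non-critical tangent spaces.** If a complex subspace `T ⊆ E₁ ⊞ E₂` projects onto
`E₂` and `dim T = q + dim E₂`, there is a complex-linear `ℓ₁ : E₁ → ℂ^q` such that `(ℓ₁ ∘ pr₁, pr₂)` is
injective on `T` (choose `ℓ₁` injective on `pr₁ (T ∩ ker pr₂)`, a `q`-dimensional subspace of `E₁`).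
[cite: Chirka1989, A2.2 (implicit function theorem: choice of coordinates), p. 305] -/
theorem exists_clm_forall_eq_zero_of_forall_exists {T : Submodule ℂ (WithLp 2 (E₁ × E₂))} {q : ℕ}
    (hT : ∀ v : E₂, ∃ u ∈ T, (ofLp u).2 = v) (hq : finrank ℂ T = q + finrank ℂ E₂) :
    ∃ ℓ₁ : E₁ →L[ℂ] EuclideanSpace ℂ (Fin q),
      ∀ u ∈ T, ℓ₁ (ofLp u).1 = 0 → (ofLp u).2 = 0 → u = 0 := by
  classical
  -- the projections as linear maps
  set P₁ : WithLp 2 (E₁ × E₂) →ₗ[ℂ] E₁ :=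
    (LinearMap.fst ℂ E₁ E₂).comp (WithLp.linearEquiv 2 ℂ (E₁ × E₂) : WithLp 2 (E₁ × E₂) →ₗ[ℂ] E₁ × E₂)
    with hP₁
  set P₂ : WithLp 2 (E₁ × E₂) →ₗ[ℂ] E₂ :=
    (LinearMap.snd ℂ E₁ E₂).comp (WithLp.linearEquiv 2 ℂ (E₁ × E₂) : WithLp 2 (E₁ × E₂) →ₗ[ℂ] E₁ × E₂)
    with hP₂
  have hP₁a : ∀ u, P₁ u = (ofLp u).1 := fun u ↦ rfl
  have hP₂a : ∀ u, P₂ u = (ofLp u).2 := fun u ↦ rfl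
  -- the restriction of `pr₂` to `T` is onto, with kernel `κ = T ∩ ker pr₂`
  set ρ : T →ₗ[ℂ] E₂ := P₂.domRestrict T with hρ
  have hρs : Surjective ρ := fun v ↦ by
    obtain ⟨u, huT, hu⟩ := hT v
    exact ⟨⟨u, huT⟩, by rw [hρ, LinearMap.domRestrict_apply, hP₂a, hu]⟩
  have hκ : finrank ℂ (LinearMap.ker ρ) = q := by
    have h := LinearMap.finrank_range_add_finrank_ker ρ
    rw [LinearMap.range_eq_top.2 hρs, finrank_top, hq] at h
    omega
  -- `V = pr₁ (κ)`, of dimension `q` (`pr₁` is injective on `ker pr₂`)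
  set f' : LinearMap.ker ρ →ₗ[ℂ] E₁ := (P₁.comp T.subtype).comp (LinearMap.ker ρ).subtype with hf'
  have hf'a : ∀ a : LinearMap.ker ρ, f' a = (ofLp ((a : T) : WithLp 2 (E₁ × E₂))).1 := fun a ↦ rfl
  have hρa : ∀ a : LinearMap.ker ρ, (ofLp ((a : T) : WithLp 2 (E₁ × E₂))).2 = 0 := fun a ↦
    LinearMap.mem_ker.1 a.2
  have hf'i : Injective f' := by
    rw [← LinearMap.ker_eq_bot, LinearMap.ker_eq_bot']
    intro a ha
    rw [hf'a] at ha
    have h0 : ((a : T) : WithLp 2 (E₁ × E₂)) = 0 := by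
      have : ofLp ((a : T) : WithLp 2 (E₁ × E₂)) = 0 := Prod.ext ha (hρa a)
      calc ((a : T) : WithLp 2 (E₁ × E₂)) = toLp 2 (ofLp ((a : T) : WithLp 2 (E₁ × E₂))) := rfl
        _ = 0 := by rw [this, WithLp.toLp_zero]
    exact Subtype.ext (Subtype.ext h0)
  set V : Submodule ℂ E₁ := LinearMap.range f' with hV
  have hVq : finrank ℂ V = q := by rw [hV, LinearMap.finrank_range_of_inj hf'i, hκ]
  -- a projection onto `V` and an identification `V ≅ ℂ^q`
  obtain ⟨V', hVV'⟩ := V.exists_isCompl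
  set proj : E₁ →ₗ[ℂ] V := V.projectionOnto V' hVV' with hproj
  have hVfin : finrank ℂ V = finrank ℂ (EuclideanSpace ℂ (Fin q)) := by
    rw [hVq, finrank_euclideanSpace_fin]
  set φ : V ≃ₗ[ℂ] EuclideanSpace ℂ (Fin q) := LinearEquiv.ofFinrankEq V _ hVfin with hφ
  refine ⟨LinearMap.toContinuousLinearMap ((φ : V →ₗ[ℂ] EuclideanSpace ℂ (Fin q)).comp proj),
    fun u huT h1 h2 ↦ ?_⟩
  -- `u ∈ κ`, so `u₁ ∈ V`, `proj u₁ = u₁`, and `φ u₁ = 0` forces `u₁ = 0`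
  have huκ : (⟨u, huT⟩ : T) ∈ LinearMap.ker ρ := LinearMap.mem_ker.2 h2
  have hu1V : (ofLp u).1 ∈ V := ⟨⟨⟨u, huT⟩, huκ⟩, rfl⟩
  have hproj1 : proj (ofLp u).1 = ⟨(ofLp u).1, hu1V⟩ :=
    Submodule.projectionOnto_apply_left hVV' ⟨_, hu1V⟩
  have hφ0 : φ ⟨(ofLp u).1, hu1V⟩ = 0 := by
    have h1' : φ (proj (ofLp u).1) = 0 := h1
    rwa [hproj1] at h1'
  have hu1 : (ofLp u).1 = 0 := by
    have := φ.map_eq_zero_iff.1 hφ0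
    simpa using congrArg Subtype.val this
  have : ofLp u = 0 := Prod.ext hu1 h2
  calc u = toLp 2 (ofLp u) := rfl
    _ = 0 := by rw [this, WithLp.toLp_zero]

end LinearAlgebra

/-! ### §3 Adapted sections at non-critical regular points -/

section Adapted

variable {E₁ : Type u} [NormedAddCommGroup E₁] [NormedSpace ℂ E₁] [FiniteDimensional ℂ E₁]
  {E₂ : Type u} [NormedAddCommGroup E₂] [NormedSpace ℂ E₂] [FiniteDimensional ℂ E₂]

/-- **Sheets adapted to the second projection.** Let `A ⊆ E₁ ⊞ E₂` be cut out near `z₀ = (x₀, t₀) ∈ A`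
by a holomorphic `g : E₁ ⊞ E₂ → ℂᶜ` with `dg(z₀)` onto, and suppose `z₀` is NON-CRITICAL: the tangent
space `ker dg(z₀)` projects onto `E₂`. Then, with `q = dim E₁ - c`, there are a complex-linear
`ℓ₁ : E₁ → ℂ^q`, the complex-linear `ℓ : (x, y) ↦ (ℓ₁ x, y) : E₁ ⊞ E₂ → ℂ^q ⊞ E₂`, an open
`W ⊆ ℂ^q ⊞ E₂`, a holomorphic section `s : W → E₁ ⊞ E₂` of `ℓ` (`ℓ (s w) = w`) and an open `N ∋ z₀`
inside the domain of `g` with `s(W) = A ∩ N` and `dg` onto along `N` (so every point of `A ∩ N` is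
regular of codimension `c`). [cite: Chirka1989, A2.2 (implicit function theorem), p. 305; §2.3, p. 29] -/
theorem exists_adapted_section {A U : Set (WithLp 2 (E₁ × E₂))} {z₀ : WithLp 2 (E₁ × E₂)} {c : ℕ}
    {g : WithLp 2 (E₁ × E₂) → (Fin c → ℂ)} (hU : IsOpen U) (hz₀U : z₀ ∈ U) (hz₀A : z₀ ∈ A)
    (hg : DifferentiableOn ℂ g U) (hAU : A ∩ U = U ∩ g ⁻¹' {0}) (hsurj : Surjective (fderiv ℂ g z₀))
    (hnc : ∀ v : E₂, ∃ u : WithLp 2 (E₁ × E₂), fderiv ℂ g z₀ u = 0 ∧ (ofLp u).2 = v)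
    {q : ℕ} (hq : finrank ℂ E₁ = q + c) :
    ∃ (ℓ₁ : E₁ →L[ℂ] EuclideanSpace ℂ (Fin q))
      (ℓ : WithLp 2 (E₁ × E₂) →L[ℂ] WithLp 2 (EuclideanSpace ℂ (Fin q) × E₂))
      (W : Set (WithLp 2 (EuclideanSpace ℂ (Fin q) × E₂)))
      (s : WithLp 2 (EuclideanSpace ℂ (Fin q) × E₂) → WithLp 2 (E₁ × E₂)) (N : Set (WithLp 2 (E₁ × E₂))),
      (∀ z, ℓ z = toLp 2 (ℓ₁ (ofLp z).1, (ofLp z).2)) ∧ IsOpen W ∧ IsOpen N ∧ z₀ ∈ N ∧ N ⊆ U ∧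
      DifferentiableOn ℂ s W ∧ (∀ w ∈ W, ℓ (s w) = w) ∧ s '' W = A ∩ N ∧
      ∀ z ∈ N, Surjective (fderiv ℂ g z) := by
  have hn : finrank ℂ (WithLp 2 (E₁ × E₂)) = finrank ℂ E₁ + finrank ℂ E₂ := by
    rw [(WithLp.linearEquiv 2 ℂ (E₁ × E₂)).finrank_eq, Module.finrank_prod]
  -- the tangent space and its dimension
  set T : Submodule ℂ (WithLp 2 (E₁ × E₂)) :=
    LinearMap.ker (fderiv ℂ g z₀ : WithLp 2 (E₁ × E₂) →ₗ[ℂ] (Fin c → ℂ)) with hT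
  have hTdim : finrank ℂ T = q + finrank ℂ E₂ := by
    have h := LinearMap.finrank_range_add_finrank_ker (fderiv ℂ g z₀ : WithLp 2 (E₁ × E₂) →ₗ[ℂ] (Fin c → ℂ))
    rw [LinearMap.range_eq_top.2 hsurj, finrank_top, Module.finrank_fin_fun, hn, hq] at h
    rw [hT]
    omega
  have hT2 : ∀ v : E₂, ∃ u ∈ T, (ofLp u).2 = v := fun v ↦ by
    obtain ⟨u, hu0, hu⟩ := hnc v
    exact ⟨u, LinearMap.mem_ker.2 hu0, hu⟩
  obtain ⟨ℓ₁, hℓ₁⟩ := exists_clm_forall_eq_zero_of_forall_exists hT2 hTdim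
  -- the adapted linear map `ℓ (x, y) = (ℓ₁ x, y)`
  set ℓ : WithLp 2 (E₁ × E₂) →L[ℂ] WithLp 2 (EuclideanSpace ℂ (Fin q) × E₂) :=
    (((WithLp.prodContinuousLinearEquiv 2 ℂ (EuclideanSpace ℂ (Fin q)) E₂).symm :
        EuclideanSpace ℂ (Fin q) × E₂ →L[ℂ] WithLp 2 (EuclideanSpace ℂ (Fin q) × E₂)).comp
      ((ℓ₁.prodMap (ContinuousLinearMap.id ℂ E₂)).comp
        (WithLp.prodContinuousLinearEquiv 2 ℂ E₁ E₂ : WithLp 2 (E₁ × E₂) →L[ℂ] E₁ × E₂))) with hℓdef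
  have hℓ : ∀ z, ℓ z = toLp 2 (ℓ₁ (ofLp z).1, (ofLp z).2) := fun z ↦ rfl
  -- `(dg(z₀), ℓ)` is bijective
  have hinj : Injective ((fderiv ℂ g z₀).prod ℓ) := by
    refine (injective_iff_map_eq_zero ((fderiv ℂ g z₀).prod ℓ)).2 fun u hu ↦ ?_
    rw [ContinuousLinearMap.prod_apply, Prod.mk_eq_zero] at hu
    have hℓu : toLp 2 (ℓ₁ (ofLp u).1, (ofLp u).2) = (0 : WithLp 2 (EuclideanSpace ℂ (Fin q) × E₂)) := by
      rw [← hℓ]; exact hu.2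
    have h12 : (ℓ₁ (ofLp u).1, (ofLp u).2) = (0 : EuclideanSpace ℂ (Fin q) × E₂) := by
      simpa using congrArg ofLp hℓu
    exact hℓ₁ u (LinearMap.mem_ker.2 hu.1) (congrArg Prod.fst h12) (congrArg Prod.snd h12)
  have hdimeq : finrank ℂ (WithLp 2 (E₁ × E₂)) =
      finrank ℂ ((Fin c → ℂ) × WithLp 2 (EuclideanSpace ℂ (Fin q) × E₂)) := by
    rw [Module.finrank_prod, Module.finrank_fin_fun,
      (WithLp.linearEquiv 2 ℂ (EuclideanSpace ℂ (Fin q) × E₂)).finrank_eq, Module.finrank_prod,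
      finrank_euclideanSpace_fin, hn, hq]
    ring
  have hbij : Bijective ((fderiv ℂ g z₀).prod ℓ) :=
    ⟨hinj, (LinearMap.injective_iff_surjective_of_finrank_eq_finrank hdimeq).1 hinj⟩
  obtain ⟨W, s, N, hW, hN, hz₀N, hNU, hs, hℓs, himg, hsurjN⟩ :=
    SCV.exists_section_of_bijective hU hz₀U hz₀A hg hAU ℓ hbij
  exact ⟨ℓ₁, ℓ, W, s, N, hℓ, hW, hN, hz₀N, hNU, hs, hℓs, himg, hsurjN⟩

end Adapted

end Literature.Geometry.Kaehler

end
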